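import Summits.BirchSwinnertonDyer.Rank1Residual.X12.CMInertTrace
import Literature.NumberTheory.EllipticCurves.SupersingularDensityDeuringCriterionProofs
import Literature.NumberTheory.EllipticCurves.ComplexMultiplicationDeuringEndReductionProofs
import Literature.NumberTheory.EllipticCurves.SupersingularDensitySerreFrobeniusProofs
import Literature.NumberTheory.EllipticCurves.GeomEndRingTransport
import Literature.NumberTheory.EllipticCurves.IsogenyHasCMIffJMemProofs
import HarnessLib

/-!
# CM elliptic curves over `ℚ` have irreducible `E[p]` at every odd prime `p` unramified in the CM
# field — condition (a) of the X12 Matar–Nekovář route as a THEOREM for every CM curve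

HONEST FRAMING (cell `b2b-bsdres`, run/shared/lean/b2b/bsd-rank1-residual/, verbatim in every
file): the goal of the cell is to DELETE the COMBINATION-SHAPED residual classes of the
Birch–Swinnerton-Dyer formula for ALL analytic-rank `≤ 1` elliptic curves over `ℚ` — "full BSD
formula for every rank `≤ 1` curve in class `C`" assembled STRICTLY from published theorems — so
that the rank-`≤ 1` remainder becomes exactly the CONSTRUCTION-SHAPED classes, which are TYPED
(missing-input `Prop`s), NOT attempted. This is not "finishing BSD". Harvest seat 1 (census owner
of class X12), generation 15. Theorems only (no definition, no named fact, no axiom); X12 REMAINS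
CONSTRUCTION-SHAPED; nothing is booked; no label and no census number moves.

## Why this file

Referee 2, R2-25.3 (REFEREE-2.md §25E): Matar–Nekovář 2019 Thm. 6.7 (1) is admissible as the
per-pair lever `T-MN19` on class X12 under conditions (a)–(e), with **(a) `irr(p)` certified as a
THEOREM or kernel certificate**. Gens 13–14 made (a) kernel on the whole 72-pair inert-bad core and
on 125/125 MN19-eligible census pairs — by the general theorems `irr_of_j_eq_zero` (`p ≥ 5`),
`irr_of_j_eq_1728` (`p` odd) plus per-pair records for the curves with `j ∈ {−3375, 8000, …}`.
This file removes (a) as a per-pair input for EVERY CM curve over `ℚ`, census or not: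

* §1 `irr_of_sq_eq_intCast` / `hasIrreducibleModPGaloisRep_of_sq_eq_intCast` — **the
  endomorphism form**: if `E/ℚ` carries a geometric endomorphism `ψ` with `ψ² = [D]`, `D < 0`,
  then `E[p]` is irreducible for every odd prime `p ∤ D` (any Weierstrass model). Proof: a
  Dirichlet prime `ℓ ≡ −1 (mod 4|D|)` with `−ℓ` a non-residue mod `p`, `ℓ > max(p, |Δ_min|, |D|, 4)`
  (`exists_prime_gt_modEq_and_not_isSquare_neg`, p204456), is inert for `D` (`(D/ℓ) = −1`,
  `CMInertTrace` §1), hence `ℓ ∣ a_ℓ` by Deuring's criterion from the reduction of endomorphisms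
  (tree THEOREM `natCast_dvd_frobeniusTrace_iff_not_isSquare_of_reduction` with the DISCHARGED
  `Silverman1994_exists_reduction_ringHom_geomEndRing_holds`; Lang Ch. 13 §4 Thm. 12), hence
  `a_ℓ = 0` by Hasse (`ℓ ≥ 5`), so `X² − a_ℓX + ℓ = X² + ℓ` is root-free mod `p` and Mazur's
  Prop. 6.3 (1) (`irr_of_frobeniusTrace_of_forall_ne_zero`, p204456) forbids a `Γ_ℚ`-stable line.
  Corollary `exists_forall_hasIrreducibleModPGaloisRep_of_hasCM`: a CM curve has irreducible
  `E[p]` for all odd `p` off the (finitely many) divisors of one integer `D < 0`.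
* §2 `hasIrreducibleModPGaloisRep_of_not_dvd_cmFieldDiscrOfJ` — **the CM-field form, effective in
  the cell's vocabulary**: for ANY elliptic `E/ℚ` and any odd prime `p` with
  `p ∤ cmFieldDiscrOfJ j(E)` (the fundamental discriminant `d_K` of the CM field read off the
  thirteen CM `j`-invariants, `Rank1Residual/Predicates`; the hypothesis forces `j(E)` to be CM):
  `E[p]` is irreducible. Proof: `E ~ E₁` with `E₁` globally minimal, CM by `𝒪_K` of the SAME field
  (`CMInertTrace` §4); a Dirichlet prime `ℓ ≡ −1 (mod 4|d_K|)` as above has `a_ℓ(E₁) = 0`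
  (`CMInertTrace` §3: `E₁ ~ E₁^{(d_K)}`, Burungale–Flach / Milne, + the twisting formula) and
  `a_ℓ(E_min) = a_ℓ(E₁)` (Faltings, isogeny invariance), then Mazur as in §1; irreducibility is
  invariant under the change to the minimal model (`Mazur1978.hasIrreducibleModPGaloisRep_smul_iff`).
* §3 cell vocabulary: **`p` odd ∧ `¬ CMRamified E p` ⟹ `Irr E p`** (`irr_of_not_cmRamified`), so
  `CMInert`/`CMSplit` pairs are never Eisenstein at odd `p`; a CM curve has only finitely many
  reducible primes, all dividing `2d_K` (`finite_setOf_red_of_hasCM`).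
* §4 the Matar–Nekovář booking shape of `HeegnerIndexRoute.lean` with `hirr` DISCHARGED on every
  X12 pair with `p ≥ 5`, `p ∤ d_K` — i.e. on ALL inert-bad and split-bad X12 pairs, in and beyond
  the census window (`bsdp_of_matarNekovar_of_not_cmRamified`); at `p ≥ 5` such a pair is
  automatically additive at `p` (`not_good_of_classX12_of_not_cmRamified`). Remaining per-pair
  inputs are exactly the referee's (b)–(e).

Sharpness: `p ∣ d_K` cannot be dropped — at a ramified `p` the kernel of `√d_K` is a
`Γ_ℚ`-stable line (the rational `7`-, `11`-, `19`-, `43`-, `67`-, `163`-isogenies of the CM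
curves with `j = −3375, −32768, …`, and the `3`-isogenies at `j = 0`); `p = 2` is excluded by
Mazur's criterion (a non-residue mod `p` is needed) and fails e.g. for `y² = x³ + x`.

## What is NOT claimed

Nothing is booked and no label moves; the Heegner index certificates (condition (d), two
implementations) are the instrument lanes'; X12 stays CONSTRUCTION-SHAPED.

References: B. Mazur, Invent. Math. 44 (1978) §5 (p. 148), §6 Prop. 6.3 (1) (p. 153) [Mazur1978];
M. Deuring (1941) [Deuring1941]; S. Lang, *Elliptic Functions*, Ch. 13 §4 Thm. 12 [Lang1987];
J. H. Silverman, *Advanced Topics*, Prop. II.4.4, II Ex. 2.12(b), App. A §3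
[SilvermanAdvancedTopics1994]; A. Burungale, M. Flach, Camb. J. Math. 12 (2024), proof of Cor. 2
[BurungaleFlach2024]; G. Faltings (1983) §5 Kor. 2 [Faltings1983Endlichkeit]; A. Matar, J. Nekovář,
JTNB 31 (2019) Thm. 6.7 (1) [MatarNekovar2019]; REFEREE-2.md §25E; harvest-1 RECLASSIFY.md §GEN-15.
-/

set_option autoImplicit false

noncomputable section

open scoped Classical NumberTheorySymbols

open WeierstrassCurve Literature.NumberTheory.EllipticCurves
  Literature.NumberTheory.EllipticCurves.Rank1Residual
  Literature.NumberTheory.EllipticCurves.Rank1Residual.Typed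
  Literature.NumberTheory.GaloisRepresentations

namespace Summit.BirchSwinnertonDyer.Rank1Residual.X12

/-! ## §0 Two elementary helpers -/

/-- A prime exceeding `|z|` does not divide `z ≠ 0`. [folklore] -/
theorem natCast_not_dvd_of_natAbs_lt {ℓ : ℕ} {z : ℤ} (hz : z ≠ 0) (h : z.natAbs < ℓ) :
    ¬ (ℓ : ℤ) ∣ z :=
  fun hd ↦ absurd (Nat.le_of_dvd (Int.natAbs_pos.mpr hz) (Int.natCast_dvd.mp hd)) (not_le.mpr h)

/-- `4m` is prime to an odd prime `p ∤ m`, and `4m − 1` is prime to `4m` (`m ≥ 1`): the side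
conditions of the Dirichlet lemma `exists_prime_gt_modEq_and_not_isSquare_neg`. [folklore] -/
theorem coprime_four_mul_of_not_dvd {m p : ℕ} (hp : p.Prime) (hp2 : p ≠ 2) (hm : 0 < m)
    (hpm : ¬ p ∣ m) : (4 * m).Coprime p ∧ (4 * m - 1).Coprime (4 * m) := by
  refine ⟨Nat.Coprime.mul_left ?_ ((Nat.Prime.coprime_iff_not_dvd hp).mpr hpm).symm, ?_⟩
  · have h2p : Nat.Coprime 2 p := (Nat.coprime_primes Nat.prime_two hp).mpr (Ne.symm hp2)
    have h := Nat.Coprime.pow_left 2 h2p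
    norm_num at h
    exact h
  · set M := 4 * m - 1 with hM
    have h4 : 4 * m = M + 1 := by omega
    rw [h4]
    exact Nat.coprime_self_add_right.mpr (Nat.coprime_one_right M)

/-! ## §1 The endomorphism form: `ψ² = [D]`, `p` odd, `p ∤ D` ⟹ `E[p]` irreducible -/

/-- **A geometric endomorphism `ψ` with `ψ² = [D]`, `D < 0`, makes `E[p]` irreducible at every odd
prime `p ∤ D`** (globally minimal model). Let `W/ℚ` be globally minimal elliptic,
`ψ ∈ End_{ℚ̄}(E)` with `ψ ∘ ψ = [D]`, `D < 0`, and `p` an odd prime with `p ∤ D`. By Dirichlet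
(`exists_prime_gt_modEq_and_not_isSquare_neg`) pick a prime `ℓ ≡ −1 (mod 4|D|)`,
`ℓ > max(p, |Δ_min|, |D|, 4)`, with `−ℓ` a non-residue mod `p`. Then `(D/ℓ) = −1`
(`not_isSquare_neg_natCast_of_mod_eq`), so `ℓ ∣ a_ℓ` by Deuring's criterion from the reduction of
endomorphisms (Lang Ch. 13 §4 Thm. 12 / Silverman *AT* II.4.4; tree theorem
`natCast_dvd_frobeniusTrace_iff_not_isSquare_of_reduction` with
`Silverman1994_exists_reduction_ringHom_geomEndRing_holds`), hence `a_ℓ = 0` by Hasse (`ℓ ≥ 5`),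
and Mazur's Prop. 6.3 (1) (`irr_of_frobeniusTrace_of_forall_ne_zero`) applies to the root-free
`X² + ℓ`. [cite: Mazur1978, §6 Prop. 6.3 (1) (p. 153)] [cite: Lang1987, Ch. 13 §4 Thm. 12 (PDF p. 140)]
[cite: SilvermanAdvancedTopics1994, Prop. II.4.4] -/
theorem irr_of_sq_eq_intCast (W : WeierstrassCurve ℚ) [W.IsElliptic] [W.IsGloballyMinimal]
    {ψ : AddMonoid.End W.geomPoints} (hψ : ψ ∈ W.geomEndRing) {D : ℤ} (hD : D < 0)
    (hψψ : ψ * ψ = (D : AddMonoid.End W.geomPoints)) (p : ℕ) [hp : Fact p.Prime] (hp2 : p ≠ 2)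
    (hpD : ¬ (p : ℤ) ∣ D) : W.HasIrreducibleModPGaloisRep p := by
  have hpp : p.Prime := hp.out
  -- `D = −m`, `m ≥ 1`
  obtain ⟨m, hm, hDm⟩ : ∃ m : ℕ, 0 < m ∧ D = -(m : ℤ) :=
    ⟨D.natAbs, Int.natAbs_pos.mpr hD.ne, by rw [Int.natCast_natAbs, abs_of_neg hD, neg_neg]⟩
  subst hDm
  have hpm : ¬ p ∣ m := fun h ↦ hpD (dvd_neg.mpr (Int.natCast_dvd_natCast.mpr h))
  obtain ⟨hmp, ham⟩ := coprime_four_mul_of_not_dvd hpp hp2 hm hpm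
  -- the Dirichlet prime
  obtain ⟨ℓ, hℓn, hℓ, hℓmod, hns⟩ := exists_prime_gt_modEq_and_not_isSquare_neg p hp2
    (m := 4 * m) (a := 4 * m - 1) (by omega) hmp ham
    (max p (max (minimalDiscriminantInt W).natAbs (max m 4)))
  haveI : Fact ℓ.Prime := ⟨hℓ⟩
  simp only [max_lt_iff] at hℓn
  obtain ⟨hpℓ, hΔℓ, hmℓ, h4ℓ⟩ := hℓn
  have hℓ2 : ℓ ≠ 2 := by omega
  have hℓΔ : ¬ (ℓ : ℤ) ∣ minimalDiscriminantInt W :=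
    natCast_not_dvd_of_natAbs_lt (minimalDiscriminantInt_ne_zero W) hΔℓ
  have hℓm : ¬ (ℓ : ℤ) ∣ -(m : ℤ) := fun h ↦
    absurd (Nat.le_of_dvd hm (Int.natCast_dvd_natCast.mp (dvd_neg.mp h))) (not_le.mpr hmℓ)
  have hgood : W.HasGoodReductionAtPrime ℓ := hasGoodReductionAtPrime_of_not_dvd W ℓ hℓΔ
  -- `ℓ` is inert: `(−m/ℓ) = −1`
  have hℓres : ℓ % (4 * m) = 4 * m - 1 := by
    have h : ℓ % (4 * m) = (4 * m - 1) % (4 * m) := hℓmod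
    rw [h, Nat.mod_eq_of_lt (by omega)]
  have hinert : ¬ IsSquare ((-(m : ℤ) : ℤ) : ZMod ℓ) := not_isSquare_neg_natCast_of_mod_eq hm hℓres
  -- Deuring: `ℓ ∣ a_ℓ`; Hasse: `a_ℓ = 0`
  have hdvd : (ℓ : ℤ) ∣ W.frobeniusTrace ℓ :=
    (natCast_dvd_frobeniusTrace_iff_not_isSquare_of_reduction
      Silverman1994_exists_reduction_ringHom_geomEndRing_holds W hψ hD hψψ ℓ hℓ2 hℓm hℓΔ).mpr hinert
  have htr : W.frobeniusTrace ℓ = 0 := (W.natCast_dvd_frobeniusTrace_iff_eq_zero ℓ h4ℓ hgood).mp hdvd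
  exact irr_of_frobeniusTrace_of_forall_ne_zero W p ℓ hpℓ.ne' hgood
    (forall_sq_sub_mul_add_ne_zero_of_trace_eq_zero_of_not_isSquare htr hns)

/-- **Model-free endomorphism form**: ANY elliptic `W/ℚ` carrying `ψ ∈ End_{ℚ̄}(E)` with
`ψ² = [D]`, `D < 0`, has irreducible `E[p]` at every odd prime `p ∤ D`. The endomorphism is
transported to a global minimal model (Silverman VIII.8.3, `hasGlobalMinimalModel_rat_holds`) by
the ring isomorphism `End_{ℚ̄}(E) ≅ End_{ℚ̄}(E_min)` of curves with the same `j`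
(`exists_ringEquiv_geomEndRing_of_j_eq`, *AEC* III.1.4(b)), and irreducibility back by
`Mazur1978.hasIrreducibleModPGaloisRep_smul_iff` (*AEC* III.3.1(b)).
[cite: Mazur1978, §6 Prop. 6.3 (1) (p. 153)] [cite: Lang1987, Ch. 13 §4 Thm. 12 (PDF p. 140)]
[cite: SilvermanAEC2009, III.1.4(b), III.3.1(b) and VIII.8.3] -/
theorem hasIrreducibleModPGaloisRep_of_sq_eq_intCast (W : WeierstrassCurve ℚ) [W.IsElliptic]
    {ψ : AddMonoid.End W.geomPoints} (hψ : ψ ∈ W.geomEndRing) {D : ℤ} (hD : D < 0)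
    (hψψ : ψ * ψ = (D : AddMonoid.End W.geomPoints)) (p : ℕ) [Fact p.Prime] (hp2 : p ≠ 2)
    (hpD : ¬ (p : ℤ) ∣ D) : W.HasIrreducibleModPGaloisRep p := by
  obtain ⟨C, hC⟩ := hasGlobalMinimalModel_rat_holds W
  haveI := hC
  obtain ⟨e, -⟩ := exists_ringEquiv_geomEndRing_of_j_eq (V₁ := C • W) (V₂ := W)
    (by rw [variableChange_j])
  have h1 : (⟨ψ, hψ⟩ : W.geomEndRing) * ⟨ψ, hψ⟩ = (D : W.geomEndRing) :=
    Subtype.ext (by push_cast; exact hψψ)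
  have h2 : e ⟨ψ, hψ⟩ * e ⟨ψ, hψ⟩ = (D : (C • W).geomEndRing) := by
    rw [← map_mul, h1, map_intCast]
  have h3 : ((e ⟨ψ, hψ⟩ : (C • W).geomEndRing) : AddMonoid.End (C • W).geomPoints) *
      (e ⟨ψ, hψ⟩ : AddMonoid.End (C • W).geomPoints) = (D : AddMonoid.End (C • W).geomPoints) := by
    have h := congrArg Subtype.val h2
    simpa using h
  exact (Mazur1978.hasIrreducibleModPGaloisRep_smul_iff W C p).mp
    (irr_of_sq_eq_intCast (C • W) (e ⟨ψ, hψ⟩).2 hD h3 p hp2 hpD)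

/-- **A CM curve has irreducible `E[p]` at every odd prime off the divisors of one `D < 0`**
(`D = ψ²` for a geometric CM endomorphism `ψ`, `exists_sq_eq_intCast_of_hasCM`, *AEC* III.6.3):
`HasCM E ⟹ ∃ D < 0, ∀ p odd prime, p ∤ D → E[p]` irreducible. Any model.
[cite: Mazur1978, §6 Prop. 6.3 (1) (p. 153)] [cite: Lang1987, Ch. 13 §4 Thm. 12 (PDF p. 140)] -/
theorem exists_forall_hasIrreducibleModPGaloisRep_of_hasCM (W : WeierstrassCurve ℚ) [W.IsElliptic]
    (hCM : W.HasCM) :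
    ∃ D : ℤ, D < 0 ∧ ∀ p : ℕ, p.Prime → p ≠ 2 → ¬ (p : ℤ) ∣ D → W.HasIrreducibleModPGaloisRep p := by
  obtain ⟨ψ, hψ, D, hD, hψψ⟩ := W.exists_sq_eq_intCast_of_hasCM hCM
  refine ⟨D, hD, fun p hp hp2 hpD ↦ ?_⟩
  haveI : Fact p.Prime := ⟨hp⟩
  exact hasIrreducibleModPGaloisRep_of_sq_eq_intCast W hψ hD hψψ p hp2 hpD

/-! ## §2 The CM-field form: `p` odd, `p ∤ d_K` ⟹ `E[p]` irreducible -/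

/-- **Irreducibility along an isogeny to CM by `𝒪_K`.** Let `W, W₁/ℚ` be globally minimal, `W ~ W₁`
over `ℚ`, `j(W₁) ∈ maximalCMJInvariants` (CM by `𝒪_K`, `d_K = cmFieldDiscr j(W₁)`), and `p` an odd
prime with `p ∤ d_K`. Then `E_W[p]` is irreducible: a Dirichlet prime `ℓ ≡ −1 (mod 4|d_K|)`,
`ℓ > max(p, |Δ_min(W)|, |Δ_min(W₁)|)`, `−ℓ` a non-residue mod `p`, has `a_ℓ(W₁) = 0` (Deuring,
`frobeniusTrace_eq_zero_of_mod_eq`) and `a_ℓ(W) = a_ℓ(W₁)` (Faltings 1983 §5 Kor. 2,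
`frobeniusTrace_eq_of_isIsogenous`), so Mazur's Prop. 6.3 (1) applies to `X² + ℓ`.
[cite: Mazur1978, §6 Prop. 6.3 (1) (p. 153)] [cite: Lang1987, Ch. 13 §4 Thm. 12 (PDF p. 140)]
[cite: Faltings1983Endlichkeit, §5 Korollar 2, (i) ⇒ (iv)] -/
theorem irr_of_isIsogenous_maximal (W W₁ : WeierstrassCurve ℚ) [W.IsElliptic]
    [W.IsGloballyMinimal] [W₁.IsElliptic] [W₁.IsGloballyMinimal] (hiso : IsIsogenous W W₁)
    (hj : W₁.j ∈ maximalCMJInvariants) (p : ℕ) [hp : Fact p.Prime] (hp2 : p ≠ 2)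
    (hpd : ¬ (p : ℤ) ∣ cmFieldDiscr W₁.j) : W.HasIrreducibleModPGaloisRep p := by
  have hpp : p.Prime := hp.out
  obtain ⟨-, hm⟩ := cmFieldDiscr_eq_neg_natAbs hj
  have hpm : ¬ p ∣ (cmFieldDiscr W₁.j).natAbs := fun h ↦ hpd (Int.natCast_dvd.mpr h)
  obtain ⟨hmp, ham⟩ := coprime_four_mul_of_not_dvd hpp hp2 hm hpm
  obtain ⟨ℓ, hℓn, hℓ, hℓmod, hns⟩ := exists_prime_gt_modEq_and_not_isSquare_neg p hp2
    (m := 4 * (cmFieldDiscr W₁.j).natAbs) (a := 4 * (cmFieldDiscr W₁.j).natAbs - 1) (by omega)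
    hmp ham (max p (max (minimalDiscriminantInt W).natAbs (minimalDiscriminantInt W₁).natAbs))
  haveI : Fact ℓ.Prime := ⟨hℓ⟩
  simp only [max_lt_iff] at hℓn
  obtain ⟨hpℓ, hΔℓ, hΔ₁ℓ⟩ := hℓn
  have hℓΔ : ¬ (ℓ : ℤ) ∣ minimalDiscriminantInt W :=
    natCast_not_dvd_of_natAbs_lt (minimalDiscriminantInt_ne_zero W) hΔℓ
  have hℓΔ₁ : ¬ (ℓ : ℤ) ∣ minimalDiscriminantInt W₁ :=
    natCast_not_dvd_of_natAbs_lt (minimalDiscriminantInt_ne_zero W₁) hΔ₁ℓ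
  have hℓres : ℓ % (4 * (cmFieldDiscr W₁.j).natAbs) = 4 * (cmFieldDiscr W₁.j).natAbs - 1 := by
    have h : ℓ % (4 * (cmFieldDiscr W₁.j).natAbs) =
        (4 * (cmFieldDiscr W₁.j).natAbs - 1) % (4 * (cmFieldDiscr W₁.j).natAbs) := hℓmod
    rw [h, Nat.mod_eq_of_lt (by omega)]
  have h₁ : W₁.frobeniusTrace ℓ = 0 := frobeniusTrace_eq_zero_of_mod_eq W₁ hj ℓ hℓres hℓΔ₁
  have hgood : W.HasGoodReductionAtPrime ℓ := hasGoodReductionAtPrime_of_not_dvd W ℓ hℓΔ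
  have hgood₁ : W₁.HasGoodReductionAtPrime ℓ := hasGoodReductionAtPrime_of_not_dvd W₁ ℓ hℓΔ₁
  have htr : W.frobeniusTrace ℓ = 0 :=
    (frobeniusTrace_eq_of_isIsogenous hiso ℓ hgood hgood₁).trans h₁
  exact irr_of_frobeniusTrace_of_forall_ne_zero W p ℓ hpℓ.ne' hgood
    (forall_sq_sub_mul_add_ne_zero_of_trace_eq_zero_of_not_isSquare htr hns)

/-- **CM curves over `ℚ`: `E[p]` is irreducible at every odd prime unramified in the CM field.**
Let `W/ℚ` be ANY elliptic curve and `p` an odd prime with `p ∤ cmFieldDiscrOfJ j(W)` — the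
fundamental discriminant `d_K ∈ {−3, −4, −7, −8, −11, −19, −43, −67, −163}` of the CM field, read
off the thirteen CM `j`-invariants (the hypothesis forces `j(W) ∈ cmJInvariants`, the table's
value being `0` elsewhere). Then `ρ̄_{W,p}` is irreducible. Proof: `W ~ W₁` globally minimal with
`j(W₁) ∈ maximalCMJInvariants` in the same field (`CMInertTrace` §4, Silverman *AT* II Ex. 2.12(b)),
`W_min ~ W ~ W₁` (`isIsogenous_of_smul`), `irr_of_isIsogenous_maximal`, and transport to `W`
(`Mazur1978.hasIrreducibleModPGaloisRep_smul_iff`). [cite: Mazur1978, §6 Prop. 6.3 (1) (p. 153)]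
[cite: Lang1987, Ch. 13 §4 Thm. 12 (PDF p. 140)] [cite: SilvermanAdvancedTopics1994, Exercise 2.12(b) and App. A §3 (p. 483)] -/
theorem hasIrreducibleModPGaloisRep_of_not_dvd_cmFieldDiscrOfJ (W : WeierstrassCurve ℚ)
    [W.IsElliptic] (p : ℕ) [Fact p.Prime] (hp2 : p ≠ 2) (hpd : ¬ (p : ℤ) ∣ cmFieldDiscrOfJ W.j) :
    W.HasIrreducibleModPGaloisRep p := by
  have hd0 : cmFieldDiscrOfJ W.j ≠ 0 := fun h ↦ hpd (by rw [h]; exact dvd_zero _)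
  have hj : W.j ∈ cmJInvariants := mem_cmJInvariants_of_cmFieldDiscrOfJ_ne_zero hd0
  obtain ⟨C, hC⟩ := hasGlobalMinimalModel_rat_holds W
  haveI := hC
  obtain ⟨W₁, hE₁, hmin₁, hiso, hj₁, hd₁⟩ :=
    exists_isGloballyMinimal_isIsogenous_maximal_cmFieldDiscr_eq W hj
  haveI := hE₁
  haveI := hmin₁
  have hiso' : IsIsogenous (C • W) W₁ := (isIsogenous_of_smul W C).trans' hiso
  exact (Mazur1978.hasIrreducibleModPGaloisRep_smul_iff W C p).mp
    (irr_of_isIsogenous_maximal (C • W) W₁ hiso' hj₁ p hp2 (by rwa [hd₁]))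

/-- For a CM curve the table value `cmFieldDiscrOfJ j(W)` is the honest `d_K ≠ 0` (Heegner–Baker–
Stark: `HasCM ⟺ j ∈ cmJInvariants`, tree theorem `hasCM_iff_j_mem_holds`).
[cite: SilvermanATAEC1994, App. A §3 (table of CM j-invariants)] -/
theorem cmFieldDiscrOfJ_ne_zero_of_hasCM (W : WeierstrassCurve ℚ) [W.IsElliptic] (hCM : W.HasCM) :
    cmFieldDiscrOfJ W.j ≠ 0 := by
  have hj : W.j ∈ cmJInvariants := (hasCM_iff_j_mem_holds W).mp hCM
  simp only [cmJInvariants, Finset.mem_insert, Finset.mem_singleton] at hj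
  rcases hj with h | h | h | h | h | h | h | h | h | h | h | h | h <;>
    rw [h] <;> norm_num [cmFieldDiscrOfJ]

/-! ## §3 Cell vocabulary: `¬ CMRamified ⟹ Irr` at odd `p`; finitely many Eisenstein primes -/

section Cell

variable (W : WeierstrassCurve ℚ) [W.IsElliptic] (p : ℕ) [hp : Fact p.Prime]

/-- **`p` odd, `p` unramified in the CM field ⟹ `irr(p)`** (cell predicates `CMRamified`, `Irr`;
any Weierstrass model; the hypothesis `¬ CMRamified W p` forces `W` to be CM).
[cite: Mazur1978, §6 Prop. 6.3 (1) (p. 153)] [cite: Lang1987, Ch. 13 §4 Thm. 12 (PDF p. 140)] -/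
theorem irr_of_not_cmRamified (hp2 : p ≠ 2) (h : ¬ CMRamified W p) : Irr W p :=
  hasIrreducibleModPGaloisRep_of_not_dvd_cmFieldDiscrOfJ W p hp2 h

/-- `p` odd and unramified in the CM field ⟹ `¬ red(p)` (never Eisenstein). [cite: Mazur1978, §6 Prop. 6.3 (1) (p. 153)] -/
theorem not_red_of_not_cmRamified (hp2 : p ≠ 2) (h : ¬ CMRamified W p) : ¬ Red W p :=
  fun hred ↦ hred (irr_of_not_cmRamified W p hp2 h)

/-- `CMInert` pairs (the potentially SUPERSINGULAR primes) are irreducible at odd `p`. [cite: Mazur1978, §6 Prop. 6.3 (1) (p. 153)] -/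
theorem irr_of_cmInert (hp2 : p ≠ 2) (h : CMInert W p) : Irr W p :=
  irr_of_not_cmRamified W p hp2 h.1

/-- `CMSplit` pairs (the potentially ORDINARY primes) are irreducible at odd `p`. [cite: Mazur1978, §6 Prop. 6.3 (1) (p. 153)] -/
theorem irr_of_cmSplit (hp2 : p ≠ 2) (h : CMSplit W p) : Irr W p :=
  irr_of_not_cmRamified W p hp2 (fun hr ↦ h.1 hr)

omit hp in
/-- **A CM curve over `ℚ` has only finitely many Eisenstein primes — all divide `2d_K`.**
[cite: Mazur1978, §6 Prop. 6.3 (1) (p. 153)] [cite: Lang1987, Ch. 13 §4 Thm. 12 (PDF p. 140)] -/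
theorem dvd_two_mul_cmFieldDiscrOfJ_of_red [Fact p.Prime] (hred : Red W p) :
    (p : ℤ) ∣ 2 * cmFieldDiscrOfJ W.j := by
  by_cases hp2 : p = 2
  · subst hp2
    exact dvd_mul_right 2 _
  · by_contra hnd
    exact hred (hasIrreducibleModPGaloisRep_of_not_dvd_cmFieldDiscrOfJ W p hp2
      (fun h ↦ hnd (dvd_mul_of_dvd_right h 2)))

omit hp in
/-- The Eisenstein primes of a CM curve over `ℚ` form a finite set (inside the divisors of
`2|d_K| ≠ 0`). [cite: Mazur1978, §6 Prop. 6.3 (1) (p. 153)] [cite: Lang1987, Ch. 13 §4 Thm. 12 (PDF p. 140)] -/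
theorem finite_setOf_red_of_hasCM (hCM : W.HasCM) :
    {q : ℕ | ∃ _ : Fact q.Prime, Red W q}.Finite := by
  have hd0 : cmFieldDiscrOfJ W.j ≠ 0 := cmFieldDiscrOfJ_ne_zero_of_hasCM W hCM
  refine (Finset.range ((2 * cmFieldDiscrOfJ W.j).natAbs + 1)).finite_toSet.subset ?_
  rintro q ⟨hq, hred⟩
  have hdvd := dvd_two_mul_cmFieldDiscrOfJ_of_red W q hred
  have h0 : 2 * cmFieldDiscrOfJ W.j ≠ 0 := mul_ne_zero two_ne_zero hd0
  have hle : q ≤ (2 * cmFieldDiscrOfJ W.j).natAbs :=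
    Nat.le_of_dvd (Int.natAbs_pos.mpr h0) (Int.natCast_dvd.mp hdvd)
  simp only [Finset.coe_range, Set.mem_Iio]
  omega

/-- At `p ≥ 5` an X12 pair with `p` unramified in the CM field is ADDITIVE at `p` (the class
predicate: `p = 2 ∨ (p = 3 ∧ ¬ CMSplit) ∨ CMRamified ∨ ¬ Good`; CM curves have no multiplicative
prime). So §4 below addresses exactly the inert-bad and split-bad X12 pairs. [folklore] -/
theorem not_good_of_classX12_of_not_cmRamified (hX : ClassX12 W p) (hp5 : 5 ≤ p)
    (h : ¬ CMRamified W p) : ¬ Good W p := by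
  rcases hX.2.2 with h2 | ⟨h3, -⟩ | hr | hng
  · omega
  · omega
  · exact absurd hr h
  · exact hng

/-! ## §4 The Matar–Nekovář booking shape with `irr(p)` discharged on every unramified X12 pair -/

/-- **X12, `p ≥ 5`, `p ∤ d_K` (every inert-bad and split-bad pair, in and beyond the census): the
Matar–Nekovář booking shape with `irr(p)` DISCHARGED.** For an X12 pair `(E, p)` (`ClassX12 W p`:
CM, `r_an = 1`) with `p ≥ 5` unramified in the CM field: granted the PUBLISHED named fact `hMN`
(Matar–Nekovář 2019 Thm. 6.7 (1)) and GZK, the per-pair certificate — `K'` imaginary quadratic with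
the Heegner hypothesis for `N`, a Heegner point `P = y_{K'}` of infinite order with
`p ∤ [E(K') : ℤP]`, `#Ш_an = q` with `ord_p q = 0` — gives Miller's `BSD(E, p)`. `irr(p)` is the
theorem `irr_of_not_cmRamified` (no engine, no record). Per pair; nothing booked (referee conditions
(b)–(e) of R2-25.3 remain). [cite: MatarNekovar2019, Thm. 6.7 (1) (p. 498)] [cite: Mazur1978, §6 Prop. 6.3 (1) (p. 153)] [cite: Miller2011LMS, §1 and Def. 1.1] -/
theorem bsdp_of_matarNekovar_of_not_cmRamified
    (hGZK : rank_eq_analyticRank_of_analyticRank_le_one)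
    {N : ℕ} [NeZero N] {K' : Type} [Field K'] [NumberField K']
    (hMN : MatarNekovar2019.thm67_sha_primary_trivial_of_irreducible N W K')
    (hX : ClassX12 W p) (hp5 : 5 ≤ p) (hram : ¬ CMRamified W p)
    (hK' : IsImaginaryQuadratic K') (hH : SatisfiesHeegnerHypothesis N K')
    {P : (W.baseChange K').toAffine.Point} (hP : IsHeegnerPoint N W K' P) (hnt : ¬ IsOfFinAddOrder P)
    (hI : ¬ p ∣ (AddSubgroup.zmultiples P).index)
    {q : ℚ} (hq : shaAn W = (q : ℂ)) (hv : padicValRat p q = 0) : BSDp W p :=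
  bsdp_of_matarNekovar_of_not_dvd_index W p hGZK hMN hX hp5 hK' hH hP hnt hI
    (irr_of_not_cmRamified W p (by omega) hram) hq hv

/-- The `r_an ≤ 1` form (no `ClassX12` wrapper) at any ODD prime `p ∤ d_K`, with the theorem's
proviso `(K', p) ≠ (ℚ(√−3), 3)` kept as an input at `p = 3`.
[cite: MatarNekovar2019, Thm. 6.7 (1) (p. 498)] [cite: Miller2011LMS, §1 and Def. 1.1] -/
theorem bsdp_of_matarNekovar_of_not_cmRamified'
    (hGZK : rank_eq_analyticRank_of_analyticRank_le_one)
    {N : ℕ} [NeZero N] {K' : Type} [Field K'] [NumberField K']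
    (hMN : MatarNekovar2019.thm67_sha_primary_trivial_of_irreducible N W K')
    (hr : W.analyticRank ≤ 1) (hp2 : p ≠ 2) (hram : ¬ CMRamified W p)
    (h3 : p = 3 → NumberField.discr K' ≠ -3)
    (hK' : IsImaginaryQuadratic K') (hH : SatisfiesHeegnerHypothesis N K')
    {P : (W.baseChange K').toAffine.Point} (hP : IsHeegnerPoint N W K' P) (hnt : ¬ IsOfFinAddOrder P)
    (hI : ¬ p ∣ (AddSubgroup.zmultiples P).index)
    {q : ℚ} (hq : shaAn W = (q : ℂ)) (hv : padicValRat p q = 0) : BSDp W p :=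
  Typed.bsdp_of_matarNekovar_of_not_dvd_index W p hGZK hMN hK' hH hP hnt hp2
    (irr_of_not_cmRamified W p hp2 hram) h3 hI hr hq hv

/-- … and the typed residue `X12.MissingInputAt W p` on such a pair at `p ≥ 5`.
[cite: MatarNekovar2019, Thm. 6.7 (1) (p. 498)] [cite: Miller2011LMS, Def. 1.1] -/
theorem missingInputAt_of_matarNekovar_of_not_cmRamified
    (hGZK : rank_eq_analyticRank_of_analyticRank_le_one)
    {N : ℕ} [NeZero N] {K' : Type} [Field K'] [NumberField K']
    (hMN : MatarNekovar2019.thm67_sha_primary_trivial_of_irreducible N W K')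
    (hX : ClassX12 W p) (hp5 : 5 ≤ p) (hram : ¬ CMRamified W p)
    (hK' : IsImaginaryQuadratic K') (hH : SatisfiesHeegnerHypothesis N K')
    {P : (W.baseChange K').toAffine.Point} (hP : IsHeegnerPoint N W K' P) (hnt : ¬ IsOfFinAddOrder P)
    (hI : ¬ p ∣ (AddSubgroup.zmultiples P).index)
    {q : ℚ} (hq : shaAn W = (q : ℂ)) (hv : padicValRat p q = 0) : X12.MissingInputAt W p :=
  missingInputAt_of_matarNekovar_of_not_dvd_index W p hGZK hMN hX hp5 hK' hH hP hnt hI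
    (irr_of_not_cmRamified W p (by omega) hram) hq hv

end Cell

end Summit.BirchSwinnertonDyer.Rank1Residual.X12

end
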